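import Summits.BirchSwinnertonDyer.BirchSwinnertonDyer.Theses.ByReductionTypeAtTwo
import Summits.BirchSwinnertonDyer.BirchSwinnertonDyer.Theorems.ByReductionTypeAtTwoOrdEisensteinHalfShaCurrency
import HarnessLib

/-!
# Route ByReductionTypeAtTwo — GLUE: `GoodOrdinaryRankZeroAtTwo` from `OrdPublishedInputsAtTwo`,
# `OrdKatoHalfAtTwo` and the DESCENT-INEQUALITY schema (seat bsd-2adic-ord-3 GEN 2; planner rider K-6)

HONEST FRAMING (cell `bsd-2adic`, HUMAN RULINGS D-0036/D-0074): a THEOREM, no definition, no named fact,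
nothing asserted; it closes nothing by itself (the three hypotheses are the route's items; the third is the
re-split child `OrdMissingLowerBoundAtTwo` of plan/routes/NEXT-ROUND.md ADDENDUM 2, stated here by its TEXT
so that this file does not wait on the Defs leaf `ByReductionTypeAtTwoOrdMissingLowerBoundDefs.lean`; the
route decl / the leaf constant unfold to this text by `Iff.rfl`).

WHAT. `goodOrdinaryRankZeroAtTwo_of_katoHalf_of_missingLowerBound :
OrdPublishedInputsAtTwo → OrdKatoHalfAtTwo → (∀ W non-CM, analyticRank = 0 → GoodOrd W 2 →
MissingLowerBoundAt W 2) → GoodOrdinaryRankZeroAtTwo` (route decls of `Theses/ByReductionTypeAtTwo.lean`,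
rev 12): per curve, the Kato half gives the upper bound `ord₂ #Ш ≤ ord₂ #Ш_an`
(`X5.O1.missingUpperBoundAt_two_of_mainConjectureLowerDivisibilityAtTwoOrd_of_kato`, Kato 17.4 (1)(2) AT
`2` + Greenberg 4.1 AT `2` + GZK + modularity), the third hypothesis the lower bound, and Miller's two halves
make `BSD(W,2)` (`EisensteinShaCurrency.bsdp_two_of_katoHalf_of_missingLowerBoundAt`). Compared with the
landed glue through the Eisenstein child (p409439 / p418559), the Eisenstein half is replaced by the WEAKER,
certificate-shaped descent inequality — equivalent to it granted the Kato half
(`EisensteinShaCurrency.eisenstein_rankZero_iff_missingLowerBoundAt_rankZero_of_ordKatoHalfAtTwo`).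

References: K. Kato, Astérisque 295 (2004), Thm. 17.4; R. Greenberg, LNM 1716 (1999), Thm. 4.1; R. L.
Miller, LMS J. Comput. Math. 14 (2011), Def. 1.1.
-/

set_option autoImplicit false

noncomputable section

open Literature.NumberTheory.EllipticCurves Literature.NumberTheory.EllipticCurves.Rank1Residual
  Literature.NumberTheory.EllipticCurves.Rank1Residual.Typed Summit.BirchSwinnertonDyer.Rank1Residual.X5

namespace Summit.BirchSwinnertonDyer.BirchSwinnertonDyer.Theorems

/-- **GLUE (rider K-6).** `OrdPublishedInputsAtTwo → OrdKatoHalfAtTwo → (descent-inequality schema) →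
GoodOrdinaryRankZeroAtTwo`, the conclusion and the first two hypotheses being the ROUTE decls of
`Theses.ByReductionTypeAtTwo` (fully qualified), the third the text of
`Theorems.OrdHalvesAtTwo.OrdMissingLowerBoundAtTwo`. Per curve: Kato half ⇒ `MissingUpperBoundAt W 2`;
+ `MissingLowerBoundAt W 2` ⇒ `MissingPPartAt W 2` ⇒ `BSDp W 2` (GZK).
[cite: Kato2004Asterisque, Thm. 17.4 (1)(2) (p. 273)] [cite: GreenbergLNM1716, Thm. 4.1 (p. 102)]
[cite: Miller2011LMS, Def. 1.1] -/
theorem goodOrdinaryRankZeroAtTwo_of_katoHalf_of_missingLowerBound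
    (hpub : Summit.BirchSwinnertonDyer.BirchSwinnertonDyer.Theses.ByReductionTypeAtTwo.OrdPublishedInputsAtTwo)
    (hK : Summit.BirchSwinnertonDyer.BirchSwinnertonDyer.Theses.ByReductionTypeAtTwo.OrdKatoHalfAtTwo)
    (hL : ∀ (W : WeierstrassCurve ℚ) [W.IsElliptic] [W.IsGloballyMinimal], ¬ W.HasCM →
      W.analyticRank = 0 → GoodOrd W 2 → MissingLowerBoundAt W 2) :
    Summit.BirchSwinnertonDyer.BirchSwinnertonDyer.Theses.ByReductionTypeAtTwo.GoodOrdinaryRankZeroAtTwo := by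
  obtain ⟨hmod, hGZK, h17, hGr⟩ := hpub
  intro W _ _ hcm hr hgo
  exact EisensteinShaCurrency.bsdp_two_of_katoHalf_of_missingLowerBoundAt W (h17 W)
    (O1.twoAdicEulerCharRankZero_zero_of_greenberg W hGr) hGZK hmod hgo hr (hK W hcm hr hgo)
    (hL W hcm hr hgo)

/-- **The same glue concluding the Theses-free parent text** (`∀` non-CM rank-`0` good-ordinary `W`,
`BSDp W 2`) from the Theses-free constants `Literature.Uncategorized.OrdPublishedInputsAtTwo` and
`Theorems.OrdHalvesAtTwo.OrdKatoHalfAtTwo` — for consumers that cannot import a route file.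
[cite: Kato2004Asterisque, Thm. 17.4 (1)(2) (p. 273)] [cite: Miller2011LMS, Def. 1.1] -/
theorem bsdp_two_rankZero_goodOrd_of_katoHalf_of_missingLowerBound
    (hpub : Literature.Uncategorized.OrdPublishedInputsAtTwo)
    (hK : Summit.BirchSwinnertonDyer.BirchSwinnertonDyer.Theorems.OrdHalvesAtTwo.OrdKatoHalfAtTwo)
    (hL : ∀ (W : WeierstrassCurve ℚ) [W.IsElliptic] [W.IsGloballyMinimal], ¬ W.HasCM →
      W.analyticRank = 0 → GoodOrd W 2 → MissingLowerBoundAt W 2) :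
    ∀ (W : WeierstrassCurve ℚ) [W.IsElliptic] [W.IsGloballyMinimal], ¬ W.HasCM → W.analyticRank = 0 →
      GoodOrd W 2 → BSDp W 2 := by
  obtain ⟨hmod, hGZK, h17, hGr⟩ := hpub
  intro W _ _ hcm hr hgo
  exact EisensteinShaCurrency.bsdp_two_of_katoHalf_of_missingLowerBoundAt W (h17 W)
    (O1.twoAdicEulerCharRankZero_zero_of_greenberg W hGr) hGZK hmod hgo hr (hK W hcm hr hgo)
    (hL W hcm hr hgo)

end Summit.BirchSwinnertonDyer.BirchSwinnertonDyer.Theorems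

end
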